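import Summits.QuantumFields.YangMills.Theorems.BalabanLadderROTWardTaylor
import HarnessLib

/-!
# Crux `ROT` (stmt-QuantumFields-20042), infinitesimal Ward route (lane B) — III: `Λ_k(D F) + Σ_x (𝓛W_k)(x) F(a_k x) → 0`; `LatticeRotWard ⟺ LatticeAngularWard`

Helper file (`--supports stmt-QuantumFields-20042`, lane `ym-rot-20042-p2`; vocabulary `Theorems/BalabanLadderROTWardDefs.lean`).

* §1 **`norm_latticeDist_rotDeriv_add_angularSum_le`** / **`tendsto_latticeDist_rotDeriv_add_angularSum`** — under the hyperscaling
  binder `MomentBounds G r a`, along every scheme in units `a` with `β_k → ∞` and the soft-bundle torus ranges, for every compactly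
  supported test function `F` with `δ`-separated support and its rotational derivative `D = dF·Y`:
  `latticeDist_k(D) + angularSum (W_k) (L_k) (a_k) F → 0`, quantitatively `‖…‖ ≤ A_F · a_k` eventually with
  `A_F = (Cκ⁴)ⁿ · 2nK(ρ+1) · M` (collar constant, Lipschitz constant of `dF`, support radius, Riemann count) — i.e. the continuum
  generator acting on the test function IS, up to `O(a_k)`, minus the lattice angular momentum acting on the centred moment function
  (the insertion of the breaking field, `…WardSBP.bdiff_torusMoment`).  Ingredients: `sum_mul_latGen_eq_neg_angularSum` (exact SBP),
  `norm_latGen_sub_rotDeriv_le` (Taylor), `abs_torusMoment_le_of_scaled_separated` (collar), `eventually_card_scaled_le` (count).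
* §1b **`norm_angularSum_eventually_le`** — what the binder DOES give: under `MomentBounds` the angular insertion is eventually
  bounded by ONE constant (`O(a_k)` comparison + the tree's `a`-uniform E0′ bound `latticeDist_norm_le_of_momentBounds` at the
  off-diagonal test function `D F`): `O(1)`, while the crux asks `o(1)`.
* §2 **`latticeRotWard_iff_latticeAngularWard`** (under `MomentBounds`; `_of_momentBounds6` under the crux's own UV binder): the
  crux's conclusion `LatticeRotWard G r a` and its Ward form `LatticeAngularWard G r a` are EQUIVALENT — the object any
  «irrelevant-operator / Symanzik» estimate of the rotation defect must bound is exactly the angular insertion on the germ.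
  (`D` for a given `F` from the tree's `GermWard.exists_schwartz_rotDeriv`.)

HONEST FRAMING: a reformulation and an `O(a_k)` comparison, kernel-checked; it does NOT bound the insertion itself (that is the open
content of the crux: E1 of the UV limit points of lattice YM₄), and nothing here is a claim about the mass gap.  The stub/crux-level
corollaries (`KingLimit ⟺ KingAngular`, `ROT ⟺ ROTAngular`, closer `rot_of_kingAngular`) are in `…WardClosers.lean`.
Refs: K. Osterwalder, R. Schrader, CMP 31 (1973) §4.2; K. Symanzik, NPB 226 (1983) 187; S. Caracciolo, G. Curci, P. Menotti,
A. Pelissetto, Ann. Phys. 197 (1990) 119; Glimm–Jaffe 1987 §6.1.  No definition, no fact, no sorry.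
-/

set_option autoImplicit false

noncomputable section

open scoped SchwartzMap BigOperators
open MeasureTheory Filter Topology Metric
open Literature.MathematicalPhysics.QuantumFieldTheory Literature.MathematicalPhysics.QuantumLattice
open Literature.MathematicalPhysics.AQFT
open Literature.Probability.LatticeModels (box Site mem_box)
open Summit.QuantumFields.YangMills.Cruxes.OSLegsFromFemtoAndGap.DlrCollarTransfer (MomentBounds MomentBounds6 LowerBounds)
open Summit.QuantumFields.YangMills.Cruxes.OSLegsAtWeakCouplingC.Sketch (Separated SmallDiam)
open Summit.QuantumFields.YangMills.Cruxes.OSLegsAtWeakCouplingC.Y2Bridge (LatticeRotWard)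
open Summit.QuantumFields.YangMills.Theorems.OSLegsFromFemtoAndGap (latticeDist torusMoment latticeDist_apply
  mul_norm_le_norm_smul_siteToE norm_smul_siteToE_sub_le integrable_prod_obs exists_collar_radius exists_valMinAbs_ge_of_norm_le
  abs_torusMoment_le_of_momentBounds momentBounds_of_momentBounds6 latticeDist_norm_le_of_momentBounds)
open Summit.QuantumFields.YangMills.Theorems.NPointIsotropy.Negative (E4)

namespace Summit.QuantumFields.YangMills.Theorems.ROT.Ward

/-! ## §1 The summation-by-parts theorem along a scheme: `Λ_k(D F) + Σ_x (𝓛W_k)(x) F(a_k x) = O(a_k)` -/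

section Main

variable {G : Type} [Group G] [TopologicalSpace G] [IsTopologicalGroup G] [CompactSpace G]
  [MeasurableSpace G] [BorelSpace G]

/-- **Lattice rotation Ward rearrangement along a scheme, with the rate (the infinitesimal route, step 1).**  Under the
hyperscaling binder `MomentBounds G r a`, along every scheme in units `a` with `β_k → ∞` and the soft-bundle torus ranges, for every
compactly supported test function `F` with `δ`-separated support and its rotational derivative `D = dF·Y`, EVENTUALLY
`‖latticeDist_k(D) + Σ_x (𝓛 W_k)(x) F(a_k x)‖ ≤ A · a_k` with ONE constant `A = (Cκ⁴)ⁿ · 2nK(ρ+1) · M` (`C, κ` collar data with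
`κ = 48/δ + 2/ℓ₄ + 24`, `K` the Lipschitz constant of `dF`, `ρ` the support radius, `M` the Riemann count of the scaled ball): the
continuum generator acting on the test function equals, up to `O(a_k)`, MINUS the lattice angular momentum acting on the centred
moment function `W_k` (summation by parts on `(ℤ⁴)ⁿ`, second-order Taylor remainder, collar bound `|W_k| ≤ (Cκ⁴)ⁿ a_k^{4n}` at
separated bulk sites, Riemann count). -/
theorem norm_latticeDist_rotDeriv_add_angularSum_le (r : LatticeRep G) {a : ℝ → ℝ} (hMB : MomentBounds G r a)
    (sch : SpeciesScheme (YMSpecies G)) (hunits : ∀ k, sch.a k = a (sch.β k)) (hβ : Tendsto sch.β atTop atTop)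
    (hranges : ∀ k, 0 ≤ sch.β k ∧ sch.a k ≤ 1 / 24 ∧ 14 ≤ sch.L k ∧ (sch.a k)⁻¹ * (sch.a k)⁻¹ ≤ sch.L k)
    {n : ℕ} (F D : 𝓢((Fin n → E4), ℂ)) (hFc : HasCompactSupport (F : (Fin n → E4) → ℂ))
    {δ : ℝ} (hδ : 0 < δ) (hFδ : tsupport (F : (Fin n → E4) → ℂ) ⊆ Separated n δ)
    (hD : ∀ x, D x = fderiv ℝ (F : (Fin n → E4) → ℂ) x
      (fun k => (x k 0) • (EuclideanSpace.single 1 1 : E4) - (x k 1) • (EuclideanSpace.single 0 1 : E4))) :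
    ∃ A : ℝ, 0 ≤ A ∧ ∀ᶠ k in atTop,
      ‖latticeDist r.ρ (sch.β k) (sch.L k) (sch.a k) r.curvature.F
          (wilsonTorusMean r.ρ (sch.β k) (sch.L k) r.curvature.F) n D +
        angularSum (torusMoment r.ρ (sch.β k) (sch.L k) r.curvature.F
          (wilsonTorusMean r.ρ (sch.β k) (sch.L k) r.curvature.F)) (sch.L k) (sch.a k) F‖ ≤ A * sch.a k := by
  classical
  -- constants: support radius, Lipschitz constant of `dF`, collar data, Riemann count
  obtain ⟨ρ, hρ0, hρ⟩ : ∃ ρ : ℝ, 0 ≤ ρ ∧ tsupport (F : (Fin n → E4) → ℂ) ⊆ closedBall (0 : Fin n → E4) ρ := by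
    obtain ⟨ρ, hρ⟩ := hFc.isCompact.isBounded.subset_closedBall 0
    exact ⟨max ρ 0, le_max_right _ _, hρ.trans (closedBall_subset_closedBall (le_max_left _ _))⟩
  obtain ⟨K, hK0, hK⟩ := exists_lipschitz_fderiv F hFc
  obtain ⟨C, β₄, ℓ₄, hℓ, hC, H⟩ := abs_torusMoment_le_of_momentBounds r hMB
  obtain ⟨M, hM0, hM⟩ := eventually_card_scaled_le (n := n) ρ sch.a sch.L sch.a_pos sch.tendsto_a sch.tendsto_L
  set κ : ℝ := 24 / (δ / 2) + 2 / ℓ₄ + 24 with hκ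
  have hκ0 : 0 < κ := by positivity
  set A : ℝ := (C * κ ^ 4) ^ n * (2 * n * K * (ρ + 1)) * M with hA
  have hA0 : 0 ≤ A := by positivity
  -- the eventual bound `‖…‖ ≤ A · a_k`
  have hev : ∀ᶠ k in atTop,
      ‖latticeDist r.ρ (sch.β k) (sch.L k) (sch.a k) r.curvature.F
          (wilsonTorusMean r.ρ (sch.β k) (sch.L k) r.curvature.F) n D +
        angularSum (torusMoment r.ρ (sch.β k) (sch.L k) r.curvature.F
          (wilsonTorusMean r.ρ (sch.β k) (sch.L k) r.curvature.F)) (sch.L k) (sch.a k) F‖ ≤ A * sch.a k := by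
    have hε : 0 < min (min 1 ℓ₄) (δ / 24) := lt_min (lt_min one_pos hℓ) (by positivity)
    filter_upwards [hβ.eventually_ge_atTop β₄, sch.tendsto_a.eventually (gt_mem_nhds hε),
      sch.tendsto_L.eventually_ge_atTop (2 * (ρ + 1)), hM] with k hkβ hka hkL hkM
    -- the regime at step `k`
    have hak : 0 < sch.a k := sch.a_pos k
    have ha1 : sch.a k ≤ 1 := (hka.le.trans (min_le_left _ _)).trans (min_le_left _ _)
    have haℓ : sch.a k ≤ ℓ₄ := (hka.le.trans (min_le_left _ _)).trans (min_le_right _ _)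
    have haδ : sch.a k * 24 ≤ δ := by
      have := hka.le.trans (min_le_right _ _)
      rwa [le_div_iff₀ (by norm_num : (0 : ℝ) < 24)] at this
    obtain ⟨-, -, hL14, hLa⟩ := hranges k
    set ak := sch.a k with hak_def
    set Lk := sch.L k with hLk_def
    set W : (Fin n → Site 4) → ℝ := torusMoment r.ρ (sch.β k) Lk r.curvature.F
      (wilsonTorusMean r.ρ (sch.β k) Lk r.curvature.F) with hW_def
    set S := Fintype.piFinset (fun _ : Fin n => box 4 Lk) with hS
    -- geometry of the support at scale `a_k`
    have hnorm_of_mem : ∀ y ∈ tsupport (F : (Fin n → E4) → ℂ), ‖y‖ ≤ ρ := fun y hy => by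
      have := hρ hy; rwa [mem_closedBall, dist_zero_right] at this
    have hcoord : ∀ (x : Fin n → Site 4) (j : Fin n) (ν : Fin 4), ak * |(x j ν : ℝ)| ≤ ‖scaleSite ak x‖ := by
      intro x j ν
      have h1 : (‖x j ν‖ : ℝ) ≤ ‖x‖ := (norm_le_pi_norm (x j) ν).trans (norm_le_pi_norm x j)
      rw [Int.norm_eq_abs] at h1
      exact (mul_le_mul_of_nonneg_left h1 hak.le).trans (mul_norm_le_norm_scaleSite hak.le x)
    -- (i) summands vanishing near the boundary: the identity `Λ_k(D) + angularSum = Σ W (D − E)`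
    have hΦ : ∀ x : Fin n → Site 4, F (scaleSite ak x) ≠ 0 → ∀ j ν, |x j ν| + 1 ≤ (Lk : ℤ) := by
      intro x hx j ν
      have hy := hnorm_of_mem _ (subset_tsupport _ (Function.mem_support.2 hx))
      have h1 : ak * |(x j ν : ℝ)| ≤ ρ := (hcoord x j ν).trans hy
      have h2 : ak * (|(x j ν : ℝ)| + 1) ≤ ak * Lk := by
        have : ak * 1 ≤ ak := by rw [mul_one]
        nlinarith
      have h3 : |(x j ν : ℝ)| + 1 ≤ Lk := le_of_mul_le_mul_left h2 hak
      exact_mod_cast h3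
    have hid : latticeDist r.ρ (sch.β k) Lk ak r.curvature.F (wilsonTorusMean r.ρ (sch.β k) Lk r.curvature.F) n D +
        angularSum W Lk ak F = ∑ x ∈ S, (W x : ℂ) * (D (scaleSite ak x) - latGen ak F x) := by
      have h := sum_mul_latGen_eq_neg_angularSum Lk ak W F hΦ
      rw [latticeDist_apply, ← neg_neg (angularSum W Lk ak F), ← h, ← sub_eq_add_neg, ← Finset.sum_sub_distrib]
      refine Finset.sum_congr rfl fun x _ => ?_
      rw [mul_sub]
      rfl
    -- (ii) the pointwise bound on the summand
    have hpt : ∀ x ∈ S, ‖(W x : ℂ) * (D (scaleSite ak x) - latGen ak F x)‖ ≤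
        (C * κ ^ 4) ^ n * ak ^ (4 * n) * (2 * n * K * (ρ + 1) * ak) *
          (if ‖scaleSite ak x‖ ≤ ρ + 1 then 1 else 0) := by
      intro x _
      by_cases hne : latGen ak F x - D (scaleSite ak x) = 0
      · rw [← neg_sub, hne, neg_zero, mul_zero, norm_zero]
        split_ifs <;> positivity
      -- a point of the support within `a_k` of `a_k x`
      have hnear : ∃ y ∈ tsupport (F : (Fin n → E4) → ℂ), ‖scaleSite ak x - y‖ ≤ ak ∧
          ∀ j l : Fin n, dist (scaleSite ak x j) (scaleSite ak x l) + 2 * ak ≥ dist (y j) (y l) := by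
        rcases exists_mem_tsupport_of_latGen_sub_rotDeriv_ne_zero F D hD ak x hne with h0 | ⟨i, μ, hiμ⟩
        · exact ⟨_, h0, by simp [hak.le], fun j l => by linarith⟩
        · refine ⟨_, hiμ, ?_, fun j l => ?_⟩
          · rw [sub_add_cancel_left, norm_neg, norm_smul, norm_contUnitVec, mul_one, Real.norm_eq_abs, abs_of_pos hak]
          · have hw : ∀ j, ‖(ak • contUnitVec i μ : Fin n → E4) j‖ ≤ ak := fun j =>
              (norm_le_pi_norm _ j).trans (by
                rw [norm_smul, norm_contUnitVec, mul_one, Real.norm_eq_abs, abs_of_pos hak])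
            have h1 := dist_triangle (scaleSite ak x j + (ak • contUnitVec i μ) j) (scaleSite ak x j) (scaleSite ak x l)
            have h2 := dist_triangle (scaleSite ak x j) (scaleSite ak x l) (scaleSite ak x l + (ak • contUnitVec i μ) l)
            have h3 : dist (scaleSite ak x j + (ak • contUnitVec i μ) j) (scaleSite ak x j) ≤ ak := by
              rw [dist_eq_norm, add_sub_cancel_left]; exact hw j
            have h4 : dist (scaleSite ak x l) (scaleSite ak x l + (ak • contUnitVec i μ) l) ≤ ak := by
              rw [dist_eq_norm, sub_add_cancel_left, norm_neg]; exact hw l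
            have h5 := dist_triangle (scaleSite ak x j + (ak • contUnitVec i μ) j) (scaleSite ak x l)
              (scaleSite ak x l + (ak • contUnitVec i μ) l)
            simp only [Pi.add_apply, ge_iff_le]
            linarith
      obtain ⟨y, hy, hxy, hdist⟩ := hnear
      have hyρ := hnorm_of_mem y hy
      have hxρ : ‖scaleSite ak x‖ ≤ ρ + ak := by
        calc ‖scaleSite ak x‖ = ‖y + (scaleSite ak x - y)‖ := by rw [add_sub_cancel]
          _ ≤ ‖y‖ + ‖scaleSite ak x - y‖ := norm_add_le _ _
          _ ≤ ρ + ak := add_le_add hyρ hxy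
      have hxρ1 : ‖scaleSite ak x‖ ≤ ρ + 1 := hxρ.trans (by linarith)
      have hsep : ∀ i j : Fin n, i ≠ j → δ / 2 ≤ dist (scaleSite ak x i) (scaleSite ak x j) := by
        intro i j hij
        have h1 : δ ≤ dist (y i) (y j) := hFδ hy i j hij
        have h2 := hdist i j
        linarith
      have hwrap : ∀ i, 2 * ‖x i‖ ≤ (Lk : ℝ) := by
        intro i
        have h1 : ak * ‖x i‖ ≤ ρ + 1 :=
          ((mul_le_mul_of_nonneg_left (norm_le_pi_norm x i) hak.le).trans
            (mul_norm_le_norm_scaleSite hak.le x)).trans hxρ1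
        have h2 : ak * (2 * ‖x i‖) ≤ ak * Lk := by nlinarith [hkL]
        exact le_of_mul_le_mul_left h2 hak
      have hWx : |W x| ≤ (C * κ ^ 4) ^ n * ak ^ (4 * n) := by
        have H' : ∀ (x : Fin n → Site 4) (R : ℕ), 1 ≤ R → (R : ℝ) * ak ≤ ℓ₄ → 4 * R + 8 ≤ Lk →
            (∀ i j : Fin n, i ≠ j → ∃ l : Fin 4,
              (2 * (R : ℤ) + 4) ≤ |((((x i l - x j l : ℤ) : ZMod (2 * Lk + 1))).valMinAbs : ℤ)|) →
            |W x| ≤ (C / (R : ℝ) ^ 4) ^ n :=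
          fun x R h1 h2 h3 h4 => H (sch.β k) hkβ Lk n x R h1 (by rw [← hunits k]; exact h2) h3 h4
        exact abs_torusMoment_le_of_scaled_separated r hℓ hC H' hak ha1 haℓ (by linarith) hL14 hLa x hwrap hsep
      have hrem : ‖latGen ak F x - D (scaleSite ak x)‖ ≤ 2 * n * K * (ρ + 1) * ak := by
        refine (norm_latGen_sub_rotDeriv_le F D hD hK0 hK ak x).trans ?_
        have h1 : ak * ‖x‖ ≤ ρ + 1 := (mul_norm_le_norm_scaleSite hak.le x).trans hxρ1
        have h3 : 2 * n * K * ak ^ 2 * ‖x‖ = 2 * n * K * ak * (ak * ‖x‖) := by ring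
        rw [h3]
        have h2 : 0 ≤ 2 * n * K * ak := by positivity
        calc 2 * n * K * ak * (ak * ‖x‖) ≤ 2 * n * K * ak * (ρ + 1) := mul_le_mul_of_nonneg_left h1 h2
          _ = 2 * n * K * (ρ + 1) * ak := by ring
      rw [if_pos hxρ1, mul_one, norm_mul, Complex.norm_real, Real.norm_eq_abs, ← neg_sub, norm_neg]
      exact mul_le_mul hWx hrem (norm_nonneg _) (by positivity)
    -- (iii) sum the pointwise bounds: a Riemann count of the scaled ball
    rw [hid]
    calc ‖∑ x ∈ S, (W x : ℂ) * (D (scaleSite ak x) - latGen ak F x)‖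
        ≤ ∑ x ∈ S, (C * κ ^ 4) ^ n * ak ^ (4 * n) * (2 * n * K * (ρ + 1) * ak) *
            (if ‖scaleSite ak x‖ ≤ ρ + 1 then 1 else 0) := (norm_sum_le _ _).trans (Finset.sum_le_sum hpt)
      _ = (C * κ ^ 4) ^ n * (2 * n * K * (ρ + 1)) * ak *
            (ak ^ (4 * n) * ((S.filter (fun x => ‖scaleSite ak x‖ ≤ ρ + 1)).card : ℝ)) := by
          rw [← Finset.mul_sum, Finset.sum_boole]
          ring
      _ ≤ (C * κ ^ 4) ^ n * (2 * n * K * (ρ + 1)) * ak * M := by gcongr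
      _ = A * ak := by rw [hA]; ring
  exact ⟨A, hA0, hev⟩

/-- **Lattice rotation Ward rearrangement along a scheme (limit form).**  Under `MomentBounds G r a`, along every scheme in units
`a` with `β_k → ∞` and the soft-bundle torus ranges, for every compactly supported test function `F` with `δ`-separated support and
its rotational derivative `D = dF·Y`: `latticeDist_k(D) + Σ_x (𝓛 W_k)(x) F(a_k x) → 0`. -/
theorem tendsto_latticeDist_rotDeriv_add_angularSum (r : LatticeRep G) {a : ℝ → ℝ} (hMB : MomentBounds G r a)
    (sch : SpeciesScheme (YMSpecies G)) (hunits : ∀ k, sch.a k = a (sch.β k)) (hβ : Tendsto sch.β atTop atTop)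
    (hranges : ∀ k, 0 ≤ sch.β k ∧ sch.a k ≤ 1 / 24 ∧ 14 ≤ sch.L k ∧ (sch.a k)⁻¹ * (sch.a k)⁻¹ ≤ sch.L k)
    {n : ℕ} (F D : 𝓢((Fin n → E4), ℂ)) (hFc : HasCompactSupport (F : (Fin n → E4) → ℂ))
    {δ : ℝ} (hδ : 0 < δ) (hFδ : tsupport (F : (Fin n → E4) → ℂ) ⊆ Separated n δ)
    (hD : ∀ x, D x = fderiv ℝ (F : (Fin n → E4) → ℂ) x
      (fun k => (x k 0) • (EuclideanSpace.single 1 1 : E4) - (x k 1) • (EuclideanSpace.single 0 1 : E4))) :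
    Tendsto (fun k =>
      latticeDist r.ρ (sch.β k) (sch.L k) (sch.a k) r.curvature.F
          (wilsonTorusMean r.ρ (sch.β k) (sch.L k) r.curvature.F) n D +
        angularSum (torusMoment r.ρ (sch.β k) (sch.L k) r.curvature.F
          (wilsonTorusMean r.ρ (sch.β k) (sch.L k) r.curvature.F)) (sch.L k) (sch.a k) F) atTop (𝓝 0) := by
  obtain ⟨A, -, hev⟩ := norm_latticeDist_rotDeriv_add_angularSum_le r hMB sch hunits hβ hranges F D hFc hδ hFδ hD
  refine squeeze_zero_norm' hev ?_
  simpa using sch.tendsto_a.const_mul A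

/-- The rotational derivative `D = dF·Y` is supported inside `tsupport F`. -/
theorem tsupport_rotDeriv_subset {n : ℕ} (F D : 𝓢((Fin n → E4), ℂ))
    (hD : ∀ x, D x = fderiv ℝ (F : (Fin n → E4) → ℂ) x
      (fun k => (x k 0) • (EuclideanSpace.single 1 1 : E4) - (x k 1) • (EuclideanSpace.single 0 1 : E4))) :
    tsupport (D : (Fin n → E4) → ℂ) ⊆ tsupport (F : (Fin n → E4) → ℂ) := by
  refine closure_minimal (fun x hx => ?_) (isClosed_tsupport _)
  by_contra hx'
  exact hx (by rw [hD x, fderiv_of_notMem_tsupport ℝ hx']; rfl)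

/-- **What the binder DOES give: the angular insertion is `O(1)`** (not `o(1)`).  Under `MomentBounds G r a`, along every admissible
scheme and for every compactly supported `δ`-separated test function `F` (`n ≥ 2`), the angular insertion `Σ_x (𝓛 W_k)(x) F(a_k x)` is
eventually bounded by ONE constant: `A_F + Kⁿ·(S₀,₄ₙ + S₆ₙ,₄ₙ + S₀,₀ + S₆ₙ,₀ + S₁₀ₙ,₀)(D F)` (the `O(a_k)` comparison plus the tree's
`a`-uniform E0′ bound `latticeDist_norm_le_of_momentBounds` at the off-diagonal test function `D F`).  The crux asks for the limit `0`;
the hyperscaling norms control the size of the insertion, never its limit. -/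
theorem norm_angularSum_eventually_le (r : LatticeRep G) {a : ℝ → ℝ} (hMB : MomentBounds G r a)
    (sch : SpeciesScheme (YMSpecies G)) (hunits : ∀ k, sch.a k = a (sch.β k)) (hβ : Tendsto sch.β atTop atTop)
    (hranges : ∀ k, 0 ≤ sch.β k ∧ sch.a k ≤ 1 / 24 ∧ 14 ≤ sch.L k ∧ (sch.a k)⁻¹ * (sch.a k)⁻¹ ≤ sch.L k)
    {n : ℕ} (hn : 2 ≤ n) (F : 𝓢((Fin n → E4), ℂ)) (hFc : HasCompactSupport (F : (Fin n → E4) → ℂ))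
    {δ : ℝ} (hδ : 0 < δ) (hFδ : tsupport (F : (Fin n → E4) → ℂ) ⊆ Separated n δ) :
    ∃ B : ℝ, 0 ≤ B ∧ ∀ᶠ k in atTop,
      ‖angularSum (torusMoment r.ρ (sch.β k) (sch.L k) r.curvature.F
          (wilsonTorusMean r.ρ (sch.β k) (sch.L k) r.curvature.F)) (sch.L k) (sch.a k) F‖ ≤ B := by
  obtain ⟨D, hD⟩ := Summit.QuantumFields.YangMills.Cruxes.OSLegsAtWeakCouplingC.Sketch.GermWard.exists_schwartz_rotDeriv F
  obtain ⟨A, hA0, hev⟩ := norm_latticeDist_rotDeriv_add_angularSum_le r hMB sch hunits hβ hranges F D hFc hδ hFδ hD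
  obtain ⟨β₄, ℓ₄, K, hℓ, hK, H⟩ := latticeDist_norm_le_of_momentBounds r hMB
  have hDoff : IsOffDiagonal D :=
    Summit.QuantumFields.YangMills.Cruxes.OSLegsAtWeakCouplingC.Sketch.GermWard.isOffDiagonal_of_tsupport_subset_separated hδ
      ((tsupport_rotDeriv_subset F D hD).trans hFδ)
  set S : ℝ := SchwartzMap.seminorm ℂ 0 (4 * n) D + SchwartzMap.seminorm ℂ (6 * n) (4 * n) D +
    SchwartzMap.seminorm ℂ 0 0 D + SchwartzMap.seminorm ℂ (6 * n) 0 D + SchwartzMap.seminorm ℂ (10 * n) 0 D with hS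
  have hS0 : 0 ≤ S := by positivity
  refine ⟨A + K ^ n * S, by positivity, ?_⟩
  have hε : 0 < min 1 ℓ₄ := lt_min one_pos hℓ
  filter_upwards [hev, hβ.eventually_ge_atTop β₄, sch.tendsto_a.eventually (gt_mem_nhds hε)] with k h1 hkβ hka
  have hak : 0 < sch.a k := sch.a_pos k
  have ha1 : sch.a k ≤ 1 := hka.le.trans (min_le_left _ _)
  have haℓ : sch.a k ≤ ℓ₄ := hka.le.trans (min_le_right _ _)
  obtain ⟨-, -, hL14, hLa⟩ := hranges k
  have h2 : ‖latticeDist r.ρ (sch.β k) (sch.L k) (sch.a k) r.curvature.F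
      (wilsonTorusMean r.ρ (sch.β k) (sch.L k) r.curvature.F) n D‖ ≤ K ^ n * S := by
    have h := H (sch.β k) hkβ (by rw [← hunits k]; exact hak) (by rw [← hunits k]; exact ha1)
      (by rw [← hunits k]; exact haℓ) (sch.L k) hL14 (by rw [← hunits k]; exact hLa) n hn D hDoff
    rwa [← hunits k] at h
  calc _ = ‖(latticeDist r.ρ (sch.β k) (sch.L k) (sch.a k) r.curvature.F
            (wilsonTorusMean r.ρ (sch.β k) (sch.L k) r.curvature.F) n D +
          angularSum (torusMoment r.ρ (sch.β k) (sch.L k) r.curvature.F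
            (wilsonTorusMean r.ρ (sch.β k) (sch.L k) r.curvature.F)) (sch.L k) (sch.a k) F) -
          latticeDist r.ρ (sch.β k) (sch.L k) (sch.a k) r.curvature.F
            (wilsonTorusMean r.ρ (sch.β k) (sch.L k) r.curvature.F) n D‖ := by rw [add_sub_cancel_left]
    _ ≤ A * sch.a k + K ^ n * S := (norm_sub_le _ _).trans (add_le_add h1 h2)
    _ ≤ A * 1 + K ^ n * S := by gcongr
    _ = A + K ^ n * S := by rw [mul_one]

end Main

/-! ## §2 `LatticeRotWard ⟺ LatticeAngularWard` under the hyperscaling binder -/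

section Equivalence

variable {G : Type} [Group G] [TopologicalSpace G] [IsTopologicalGroup G] [CompactSpace G]
  [MeasurableSpace G] [BorelSpace G]

/-- **ROT ⇒ Ward form** under the hyperscaling binder: the angular insertion is `−Λ_k(D F) + o(1)`. -/
theorem latticeAngularWard_of_latticeRotWard (r : LatticeRep G) {a : ℝ → ℝ} (hMB : MomentBounds G r a)
    (h : LatticeRotWard G r a) : LatticeAngularWard G r a := by
  intro sch hunits hβ hranges
  obtain ⟨r₀, hr₀, hrot⟩ := h sch hunits hβ hranges
  refine ⟨r₀, hr₀, fun n hn F hFoff hFc hFδ hFr => ?_⟩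
  obtain ⟨δ, hδ, hFδ'⟩ := hFδ
  obtain ⟨D, hD⟩ := Summit.QuantumFields.YangMills.Cruxes.OSLegsAtWeakCouplingC.Sketch.GermWard.exists_schwartz_rotDeriv F
  have h1 := hrot n hn F D hFoff hFc ⟨δ, hδ, hFδ'⟩ hFr hD
  have h2 := tendsto_latticeDist_rotDeriv_add_angularSum r hMB sch hunits hβ hranges F D hFc hδ hFδ' hD
  simpa using h2.sub h1

/-- **Ward form ⇒ ROT** under the hyperscaling binder: `Λ_k(D F)` is minus the angular insertion `+ o(1)`. -/
theorem latticeRotWard_of_latticeAngularWard (r : LatticeRep G) {a : ℝ → ℝ} (hMB : MomentBounds G r a)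
    (h : LatticeAngularWard G r a) : LatticeRotWard G r a := by
  intro sch hunits hβ hranges
  obtain ⟨r₀, hr₀, hang⟩ := h sch hunits hβ hranges
  refine ⟨r₀, hr₀, fun n hn F D hFoff hFc hFδ hFr hD => ?_⟩
  obtain ⟨δ, hδ, hFδ'⟩ := hFδ
  have h1 := hang n hn F hFoff hFc ⟨δ, hδ, hFδ'⟩ hFr
  have h2 := tendsto_latticeDist_rotDeriv_add_angularSum r hMB sch hunits hβ hranges F D hFc hδ hFδ' hD
  simpa using h2.sub h1

/-- **`LatticeRotWard ⟺ LatticeAngularWard` under `MomentBounds`.** -/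
theorem latticeRotWard_iff_latticeAngularWard (r : LatticeRep G) {a : ℝ → ℝ} (hMB : MomentBounds G r a) :
    LatticeRotWard G r a ↔ LatticeAngularWard G r a :=
  ⟨latticeAngularWard_of_latticeRotWard r hMB, latticeRotWard_of_latticeAngularWard r hMB⟩

/-- **`LatticeRotWard ⟺ LatticeAngularWard` under the crux's own UV binder `MomentBounds6`.** -/
theorem latticeRotWard_iff_latticeAngularWard_of_momentBounds6 (r : LatticeRep G) (a : ℝ → ℝ)
    (h6 : MomentBounds6 G r a) : LatticeRotWard G r a ↔ LatticeAngularWard G r a :=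
  latticeRotWard_iff_latticeAngularWard r (momentBounds_of_momentBounds6 r a h6)

end Equivalence

end Summit.QuantumFields.YangMills.Theorems.ROT.Ward

end
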